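import Summits.CriticalPhenomena.PercolationContinuityZ3.Theorems.PercNearOneGluingNoHeavyLowerTailSahiMixtureTopFive
import Summits.CriticalPhenomena.PercolationContinuityZ3.Theorems.PercNearOneGluingNoHeavyLowerTailSahiMixtureHereditary

/-!
# The n = 5 singleton ladder: OR-ing a coin into TWO of five hereditarily positive events keeps `E_5` Bernstein-positive — the exact cell identity
# (order 5, two members mixed), closed form of ttrl cp-mix2's constant-multiplier certificates

Support file of the one-cut programme (crux `NoHeavyLowerTail`, stmt-CriticalPhenomena-4575; cell `prim-masterthm`, seat P3, gen 9;
`run/shared/lean/prim/prim-masterthm/prim-masterthm-p3/HIERARCHY.md` §15(h), §17).  The `n = 4` analogue is `SahiMixture.sahiE_four_orCoin_two_eq`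
(`…SahiMixtureHereditaryFour`, gen 5); the coin moments `exc_or₁…₅` and Sahi's set-partition form `sahiE_five` come from `…SahiMixtureTopFive` / `SetPartitionForm`.

CONTEXT.  H-MIX(5) is FALSE (`…SahiMixtureHereditaryCex5`; and a coin OR-ed into THREE of five hereditarily positive events makes `E_5` itself negative — three exact
witnesses, HIERARCHY §15(g),(h)).  The census lane ttrl cp-mix2 (MIXCOMB.md §18.6, certs/her5/singleton52_F01/) certified that the (5,2) SINGLETON CELL — the top row
after OR-ing a coin into TWO of five members — is nonnegative on the hereditary class with CONSTANT multipliers, i.e. by a closed identity.  This file is that identity.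
* **`sahiE_five_orCoin_two_eq`** — for ANY probability weight and ANY five events, with `H` an independent coin of bias `h`:
  `E_5(A_0∪H, A_1∪H, A_2, A_3, A_4) = (1−h)²·E_5(A) + h(1−h)·W + 6h²·E_3(A_2,A_3,A_4)`,
  `W = 3E_4(1_{A_0}1_{A_1}, A_2, A_3, A_4) + (6 + 2μ(Ā_0Ā_1))·E_3(A_2,A_3,A_4) + Σ_{{i,j,k}={2,3,4}} μ(Ā_0Ā_1A_k)·Cov(A_i,A_j) + 6μ(Ā_0 ∩ Ā_1 ∩ A_2 ∩ A_3 ∩ A_4)`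
  (degree 2 in `h`; at `h = 1` the value is `E_5(Ω,Ω,A_2,A_3,A_4) = 6E_3(A_2,A_3,A_4)`).
* **`bernsteinPos_five_orCoin_two_of_hereditary`** — hence if `E_5(A) ≥ 0`, the DERIVED quartic row `E_4(A_0∩A_1, A_2, A_3, A_4) ≥ 0`, `E_3(A_2,A_3,A_4) ≥ 0` and the three
  covariances `Cov(A_i,A_j) ≥ 0` (`i,j ∈ {2,3,4}`) hold — all of them rows of the HEREDITARY class `𝒦_5` — the mixture is Bernstein-positive of degree `5`;
  `sahiE_five_orCoin_two_nonneg_of_hereditaryAllOrders` — in particular `≥ 0` for `h ∈ [0,1]` whenever `A` is hereditarily all-orders positive.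
THE n = 5 SINGLETON LADDER (coin OR-ed into `f` of five hereditarily positive events, top row): `f = 1` trivial, `f = 2` TRUE (this file), `f = 3` FALSE (exact witnesses),
`f = 4` = SUBTOP(5) open (numerical infimum 0, no low-degree certificate), `f = 5` = TOP(5) (`…SahiMixtureTopFive`).  Every term of `W` is a product of a nonnegative moment
with a hereditary row, so the identity lifts verbatim to the comb level (products/sums of comb-positive functionals).  HONEST FRAMING: one cell; H-MIX(5) itself is false,
and nothing is claimed about Sahi's `C_k`. [this work]
-/

noncomputable section

open scoped Classical

namespace Summit.CriticalPhenomena.PercolationContinuityZ3.Theorems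

open Finset Function
open Literature.Combinatorics.Sahi2008
open Literature.Probability.Percolation.BHK2006 (ind_le_one)
open Literature.Probability.Percolation.DecisionTree (ind ind_of_mem ind_of_not_mem ind_nonneg)

namespace SahiMixture

section HereditaryFive

variable {α : Type*} [Fintype α] {μ : α → ℝ} (hμ : ∀ a, 0 ≤ μ a) (hμ1 : ∑ a, μ a = 1) (A0 A1 A2 A3 A4 : Set α)
include hμ1

set_option maxHeartbeats 1600000 in
/-- **The order-5, two-members-mixed identity** (module docstring).  With `a_S = E ∏_{i∈S} 1_{A_i}`:
`E_5(A_0∪H, A_1∪H, A_2, A_3, A_4) = (1−h)²E_5 + h(1−h)[3E_4(1_{A_0}1_{A_1},A_2,A_3,A_4) + (6 + 2(1 − a_0 − a_1 + a_01))E_3(A_2,A_3,A_4)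
 + (a_4 − a_04 − a_14 + a_014)(a_23 − a_2a_3) + (a_3 − a_03 − a_13 + a_013)(a_24 − a_2a_4) + (a_2 − a_02 − a_12 + a_012)(a_34 − a_3a_4) + 6(a_234 − a_0234 − a_1234 + a_01234)]
 + 6h²E_3(A_2,A_3,A_4)`. [this work] -/
theorem sahiE_five_orCoin_two_eq (h : ℝ) :
    sahiE (coinWeight μ h) 5
        ![ind (orCoin A0 true), ind (orCoin A1 true), ind (orCoin A2 false), ind (orCoin A3 false), ind (orCoin A4 false)]
      = (1 - h) ^ 2 * sahiE μ 5 ![ind A0, ind A1, ind A2, ind A3, ind A4]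
        + h * (1 - h) *
          (3 * sahiE μ 4 ![ind A0 * ind A1, ind A2, ind A3, ind A4]
            + (6 + 2 * (1 - ex μ (ind A0) - ex μ (ind A1) + ex μ (ind A0 * ind A1))) * sahiE μ 3 ![ind A2, ind A3, ind A4]
            + (ex μ (ind A4) - ex μ (ind A0 * ind A4) - ex μ (ind A1 * ind A4) + ex μ (ind A0 * ind A1 * ind A4))
                * (ex μ (ind A2 * ind A3) - ex μ (ind A2) * ex μ (ind A3))
            + (ex μ (ind A3) - ex μ (ind A0 * ind A3) - ex μ (ind A1 * ind A3) + ex μ (ind A0 * ind A1 * ind A3))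
                * (ex μ (ind A2 * ind A4) - ex μ (ind A2) * ex μ (ind A4))
            + (ex μ (ind A2) - ex μ (ind A0 * ind A2) - ex μ (ind A1 * ind A2) + ex μ (ind A0 * ind A1 * ind A2))
                * (ex μ (ind A3 * ind A4) - ex μ (ind A3) * ex μ (ind A4))
            + 6 * (ex μ (ind A2 * ind A3 * ind A4) - ex μ (ind A0 * ind A2 * ind A3 * ind A4) - ex μ (ind A1 * ind A2 * ind A3 * ind A4)
                + ex μ (ind A0 * ind A1 * ind A2 * ind A3 * ind A4)))
        + 6 * h ^ 2 * sahiE μ 3 ![ind A2, ind A3, ind A4] := by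
  rw [sahiE_five, sahiE_five, sahiE_four, sahiE_three]
  simp only [exc_or₅, exc_or₄, exc_or₃, exc_or₂, exc_or₁ μ h hμ1, cond_true, cond_false, one_mul, mul_one, ex_one hμ1]
  ring

include hμ

omit hμ1 in
/-- Inclusion–exclusion moments of `Ā_0 ∩ Ā_1 ∩ B` are nonnegative: `E[g] − E[1_{A_0}g] − E[1_{A_1}g] + E[1_{A_0}1_{A_1}g] ≥ 0` for `0 ≤ g`. [folklore] -/
theorem ex_notTwo_mul_nonneg (g : α → ℝ) (hg : ∀ a, 0 ≤ g a) :
    0 ≤ ex μ g - ex μ (ind A0 * g) - ex μ (ind A1 * g) + ex μ (ind A0 * ind A1 * g) := by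
  have h0 : 0 ≤ ex μ (fun a => (1 - ind A0 a) * (1 - ind A1 a) * g a) :=
    ex_nonneg hμ fun a => mul_nonneg (mul_nonneg (sub_nonneg.2 (ind_le_one A0 a)) (sub_nonneg.2 (ind_le_one A1 a))) (hg a)
  have e := ex_eq_lin μ (fun a => (1 - ind A0 a) * (1 - ind A1 a) * g a) ![1, -1, -1, 1] ![g, ind A0 * g, ind A1 * g, ind A0 * ind A1 * g]
    (fun a => by simp [Fin.sum_univ_succ]; ring)
  simp only [Fin.sum_univ_succ, Fin.sum_univ_zero, Matrix.cons_val_zero, Matrix.cons_val_succ] at e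
  linarith

/-- **The (5,2) singleton cell is a theorem on the hereditary class.**  If `E_5(A) ≥ 0`, the derived quartic row `E_4(A_0∩A_1, A_2, A_3, A_4) ≥ 0`,
`E_3(A_2,A_3,A_4) ≥ 0` and `Cov(A_i,A_j) ≥ 0` for `i,j ∈ {2,3,4}`, then OR-ing an independent coin into `A_0, A_1` is Bernstein-positive of degree `5`. [this work] -/
theorem bernsteinPos_five_orCoin_two_of_hereditary (hE5 : 0 ≤ sahiE μ 5 ![ind A0, ind A1, ind A2, ind A3, ind A4])
    (hE4d : 0 ≤ sahiE μ 4 ![ind A0 * ind A1, ind A2, ind A3, ind A4]) (hE3 : 0 ≤ sahiE μ 3 ![ind A2, ind A3, ind A4])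
    (hC23 : ex μ (ind A2) * ex μ (ind A3) ≤ ex μ (ind A2 * ind A3)) (hC24 : ex μ (ind A2) * ex μ (ind A4) ≤ ex μ (ind A2 * ind A4))
    (hC34 : ex μ (ind A3) * ex μ (ind A4) ≤ ex μ (ind A3 * ind A4)) :
    BernsteinPos 5 (fun h => sahiE (coinWeight μ h) 5
      ![ind (orCoin A0 true), ind (orCoin A1 true), ind (orCoin A2 false), ind (orCoin A3 false), ind (orCoin A4 false)]) := by
  -- the nonnegative moments of `Ā_0 ∩ Ā_1 ∩ (·)`
  have hD : 0 ≤ 1 - ex μ (ind A0) - ex μ (ind A1) + ex μ (ind A0 * ind A1) := by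
    have h := ex_notTwo_mul_nonneg hμ A0 A1 (fun _ => 1) fun _ => zero_le_one
    have e1 : ex μ (fun _ : α => (1 : ℝ)) = 1 := ex_one hμ1
    have e2 : (ind A0 * fun _ : α => (1 : ℝ)) = ind A0 := by funext a; simp
    have e3 : (ind A1 * fun _ : α => (1 : ℝ)) = ind A1 := by funext a; simp
    have e4 : (ind A0 * ind A1 * fun _ : α => (1 : ℝ)) = ind A0 * ind A1 := by funext a; simp
    rw [e1, e2, e3, e4] at h
    exact h
  have hD2 := ex_notTwo_mul_nonneg hμ A0 A1 (ind A2) (ind_nonneg A2)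
  have hD3 := ex_notTwo_mul_nonneg hμ A0 A1 (ind A3) (ind_nonneg A3)
  have hD4 := ex_notTwo_mul_nonneg hμ A0 A1 (ind A4) (ind_nonneg A4)
  have hD234 : 0 ≤ ex μ (ind A2 * ind A3 * ind A4) - ex μ (ind A0 * ind A2 * ind A3 * ind A4) - ex μ (ind A1 * ind A2 * ind A3 * ind A4)
      + ex μ (ind A0 * ind A1 * ind A2 * ind A3 * ind A4) := by
    have h := ex_notTwo_mul_nonneg hμ A0 A1 (ind A2 * ind A3 * ind A4)
      fun a => mul_nonneg (mul_nonneg (ind_nonneg A2 a) (ind_nonneg A3 a)) (ind_nonneg A4 a)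
    have e2 : ind A0 * (ind A2 * ind A3 * ind A4) = ind A0 * ind A2 * ind A3 * ind A4 := by funext a; simp only [Pi.mul_apply]; ring
    have e3 : ind A1 * (ind A2 * ind A3 * ind A4) = ind A1 * ind A2 * ind A3 * ind A4 := by funext a; simp only [Pi.mul_apply]; ring
    have e4 : ind A0 * ind A1 * (ind A2 * ind A3 * ind A4) = ind A0 * ind A1 * ind A2 * ind A3 * ind A4 := by
      funext a; simp only [Pi.mul_apply]; ring
    rw [e2, e3, e4] at h
    exact h
  have hC23' : 0 ≤ ex μ (ind A2 * ind A3) - ex μ (ind A2) * ex μ (ind A3) := sub_nonneg.2 hC23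
  have hC24' : 0 ≤ ex μ (ind A2 * ind A4) - ex μ (ind A2) * ex μ (ind A4) := sub_nonneg.2 hC24
  have hC34' : 0 ≤ ex μ (ind A3 * ind A4) - ex μ (ind A3) * ex μ (ind A4) := sub_nonneg.2 hC34
  have hW : 0 ≤ 3 * sahiE μ 4 ![ind A0 * ind A1, ind A2, ind A3, ind A4]
      + (6 + 2 * (1 - ex μ (ind A0) - ex μ (ind A1) + ex μ (ind A0 * ind A1))) * sahiE μ 3 ![ind A2, ind A3, ind A4]
      + (ex μ (ind A4) - ex μ (ind A0 * ind A4) - ex μ (ind A1 * ind A4) + ex μ (ind A0 * ind A1 * ind A4))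
          * (ex μ (ind A2 * ind A3) - ex μ (ind A2) * ex μ (ind A3))
      + (ex μ (ind A3) - ex μ (ind A0 * ind A3) - ex μ (ind A1 * ind A3) + ex μ (ind A0 * ind A1 * ind A3))
          * (ex μ (ind A2 * ind A4) - ex μ (ind A2) * ex μ (ind A4))
      + (ex μ (ind A2) - ex μ (ind A0 * ind A2) - ex μ (ind A1 * ind A2) + ex μ (ind A0 * ind A1 * ind A2))
          * (ex μ (ind A3 * ind A4) - ex μ (ind A3) * ex μ (ind A4))
      + 6 * (ex μ (ind A2 * ind A3 * ind A4) - ex μ (ind A0 * ind A2 * ind A3 * ind A4) - ex μ (ind A1 * ind A2 * ind A3 * ind A4)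
          + ex μ (ind A0 * ind A1 * ind A2 * ind A3 * ind A4)) := by
    have h1 : 0 ≤ (6 + 2 * (1 - ex μ (ind A0) - ex μ (ind A1) + ex μ (ind A0 * ind A1))) * sahiE μ 3 ![ind A2, ind A3, ind A4] :=
      mul_nonneg (by linarith) hE3
    have h2 := mul_nonneg hD4 hC23'
    have h3 := mul_nonneg hD3 hC24'
    have h4 := mul_nonneg hD2 hC34'
    linarith
  refine ((((bp_g2.smul hE5).add (bp_hg.smul hW)).add (bp_h2.smul (mul_nonneg (by norm_num : (0:ℝ) ≤ 6) hE3))).mono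
    (by norm_num)).congr fun h _ _ => ?_
  rw [sahiE_five_orCoin_two_eq hμ1 A0 A1 A2 A3 A4 h]
  ring

/-- **Corollary**: for a hereditarily all-orders positive quintuple (`HereditaryAllOrders`), OR-ing an independent coin of any bias `h ∈ [0,1]` into two members keeps
`E_5 ≥ 0`. [this work] -/
theorem sahiE_five_orCoin_two_nonneg_of_hereditaryAllOrders (A : Fin 5 → Set α) (hA : HereditaryAllOrders μ A) {h : ℝ} (h0 : 0 ≤ h) (h1 : h ≤ 1) :
    0 ≤ sahiE (coinWeight μ h) 5
      ![ind (orCoin (A 0) true), ind (orCoin (A 1) true), ind (orCoin (A 2) false), ind (orCoin (A 3) false), ind (orCoin (A 4) false)] := by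
  have row : ∀ (m : ℕ) (K : Fin m → Finset (Fin 5)), 0 ≤ sahiE μ m (fun j => ind (⋂ i ∈ K j, A i)) := hA
  -- the six hereditary rows used
  have hE5 : 0 ≤ sahiE μ 5 ![ind (A 0), ind (A 1), ind (A 2), ind (A 3), ind (A 4)] := by
    have h := row 5 (fun j => {j})
    refine le_of_le_of_eq h ?_
    congr 1; funext j
    rw [Finset.set_biInter_singleton]
    fin_cases j <;> rfl
  have hE4d : 0 ≤ sahiE μ 4 ![ind (A 0) * ind (A 1), ind (A 2), ind (A 3), ind (A 4)] := by
    have h := row 4 ![{0, 1}, {2}, {3}, {4}]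
    refine le_of_le_of_eq h ?_
    congr 1; funext j
    fin_cases j
    · show ind (⋂ i ∈ ({0, 1} : Finset (Fin 5)), A i) = ind (A 0) * ind (A 1)
      have e01 : (⋂ i ∈ ({0, 1} : Finset (Fin 5)), A i) = A 0 ∩ A 1 := by ext a; simp
      rw [e01]
      funext a
      simp only [Pi.mul_apply]
      by_cases ha : a ∈ A 0 <;> by_cases hb : a ∈ A 1 <;>
        simp [ha, hb, ind_of_mem, ind_of_not_mem, Set.mem_inter_iff]
    · show ind (⋂ i ∈ ({2} : Finset (Fin 5)), A i) = ind (A 2); rw [Finset.set_biInter_singleton]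
    · show ind (⋂ i ∈ ({3} : Finset (Fin 5)), A i) = ind (A 3); rw [Finset.set_biInter_singleton]
    · show ind (⋂ i ∈ ({4} : Finset (Fin 5)), A i) = ind (A 4); rw [Finset.set_biInter_singleton]
  have hE3 : 0 ≤ sahiE μ 3 ![ind (A 2), ind (A 3), ind (A 4)] := by
    have h := row 3 ![{2}, {3}, {4}]
    refine le_of_le_of_eq h ?_
    congr 1; funext j
    fin_cases j
    · show ind (⋂ i ∈ ({2} : Finset (Fin 5)), A i) = ind (A 2); rw [Finset.set_biInter_singleton]
    · show ind (⋂ i ∈ ({3} : Finset (Fin 5)), A i) = ind (A 3); rw [Finset.set_biInter_singleton]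
    · show ind (⋂ i ∈ ({4} : Finset (Fin 5)), A i) = ind (A 4); rw [Finset.set_biInter_singleton]
  have hcov : ∀ i j : Fin 5, ex μ (ind (A i)) * ex μ (ind (A j)) ≤ ex μ (ind (A i) * ind (A j)) := by
    intro i j
    have h := row 2 ![{i}, {j}]
    rw [sahiE_two_apply] at h
    simp only [Matrix.cons_val_zero, Matrix.cons_val_one, Finset.set_biInter_singleton] at h
    linarith
  exact (bernsteinPos_five_orCoin_two_of_hereditary hμ hμ1 (A 0) (A 1) (A 2) (A 3) (A 4) hE5 hE4d hE3 (hcov 2 3) (hcov 2 4) (hcov 3 4)).nonneg h0 h1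

end HereditaryFive

end SahiMixture

end Summit.CriticalPhenomena.PercolationContinuityZ3.Theorems

end
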